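import Literature.NumberTheory.Automorphic.Liu2021.Thm418Transport
import Literature.NumberTheory.Automorphic.Liu2021.AppendixC.Prop413DataOfTower
import HarnessLib

/-!
# The transported [Liu2021, Thm. 4.18] datum does not read the source family

Topic `NumberTheory/Automorphic/Liu2021`.  Structural `rfl` certificate, THEOREMS ONLY; nothing of [Liu2021] is asserted; no named fact;
HC_CM is NOT proved.

`Thm418Data.transport D G′ φ Eps′ epsOf′ Chi′ ω′ ρ′` (`Thm418Transport.lean`) REPLACES the group `G`, the collections `Eps`, the map
`epsOf`, the characters `Chi` and the summands `omega ∕ rho` of `D`, keeping `n, 𝕍, μ, 𝒜(μ), Ω(μ)` and `Hom_E(A_K, A_μ)_ℚ` (read through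
`φ`).  Hence, for a datum presented through Appendix C over μ-UNIFORM carriers, `D = toThm418Data C (U.rest t)`
(`AppendixC/Prop413DataOfTower.lean`), the transported datum depends on the Appendix-C datum `C` and the tail `t` only — NOT on the
μ-uniform source family `U`: for any two families `U, U′` the two transported data are the same term (`rfl`), and so are the two
[Thm. 4.18] AS PRINTED statements (`Iff.rfl`).  This is the kernel certificate behind PLANNER-A's nit n1 on the successor END editions
✔ `ClosedPrintedMuKeyIdentLemD3DelRecConjOmegaT` :122 ∕ ✔ `ClosedPrintedMuKeyIdentDelRecConjOmegaT`: the source-family argument of the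
transported [Thm. 4.18] row is inert.

Credit: mutate-1 g7 (desk lemma J8 `transportSourceFamilyNotRead`), mutate-3 g5, omega-twin-2 g2 (`sg/SgGeneric.lean`); pen omega-twin-2 g3
(cell J8-TREE, PLANNER-A a34 (2) ∕ a36).

References: [Liu2021] Y. Liu, *Fourier–Jacobi cycles and arithmetic relative trace formula*, Camb. J. Math. 9 (2021), Thm. 4.18
(FJcycle.tex l. 2232–2245), Def. 4.11–4.12, Def. 4.16, Rem. 4.17, §4.2 l. 2053–2074.
-/

set_option autoImplicit false

noncomputable section

open NumberField

namespace Literature.NumberTheory.Automorphic.Liu2021.AppendixC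

/-- **`transport` discards the μ-uniform source family.**  For an Appendix-C datum `C`, a tail `t` at a weight-one conjugate-symplectic
`μ`, and ANY two μ-uniform families `U, U′` over `C`, the transports of `toThm418Data C (U.rest t)` and of `toThm418Data C (U′.rest t)`
along the same `G′, φ, Eps′, epsOf′, Chi′, ω′, ρ′` are the same datum — field for field, by `rfl` (`transport` replaces
`G ∕ Eps ∕ epsOf ∕ Chi ∕ omega ∕ rho`, so the transported datum does not read the source family).  Structural; nothing of [Liu2021] is
asserted. [cite: Liu2021, Thm. 4.18 (l. 2232–2245), Def. 4.11–4.12] -/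
theorem transport_toThm418Data_rest_eq {F E : Type} [Field F] [NumberField F] [IsTotallyReal F] [Field E] [NumberField E]
    [Algebra F E] [IsTotallyComplex E] [Algebra.IsQuadraticExtension F E] {P5 : PropC5Data F E} {isotropicAt : ℕ → Prop}
    (C : Sec42Data P5 isotropicAt) (U U' : UniformOmega C) {μ : IdeleClassGroup E →ₜ* Circle}
    {hμ : letI : IsCMField E := isCMField F E; IdeleClassGroup.IsConjugateSymplectic E μ} (t : RestTail C μ hμ)
    (G' : Type) [Group G'] [TopologicalSpace G'] [IsTopologicalGroup G'] (φ : G' ≃ₜ* C.G)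
    (Eps' : Type) (epsOf' : E → Eps') (Chi' : Type) (omega' : Eps' → Chi' → Type)
    [∀ ε χ, AddCommGroup (omega' ε χ)] [∀ ε χ, Module ℂ (omega' ε χ)]
    (rho' : ∀ ε χ, Representation ℂ G' (omega' ε χ)) :
    (toThm418Data C (U.rest t)).transport G' φ Eps' epsOf' Chi' omega' rho' =
      (toThm418Data C (U'.rest t)).transport G' φ Eps' epsOf' Chi' omega' rho' := rfl

/-- **… hence the same [Liu2021, Thm. 4.18] AS PRINTED statement** for the two transported data (`Iff.rfl`): citing the printed theorem at
the transport of `toThm418Data C (U.rest t)` is citing it at the transport of `toThm418Data C (U′.rest t)`, for any μ-uniform families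
`U, U′`.  Structural; nothing of [Liu2021] is asserted. [cite: Liu2021, Thm. 4.18 (l. 2232–2245), Def. 4.11–4.12] -/
theorem thm418AsPrinted_transport_rest_iff {F E : Type} [Field F] [NumberField F] [IsTotallyReal F] [Field E] [NumberField E]
    [Algebra F E] [IsTotallyComplex E] [Algebra.IsQuadraticExtension F E] {P5 : PropC5Data F E} {isotropicAt : ℕ → Prop}
    (C : Sec42Data P5 isotropicAt) (U U' : UniformOmega C) {μ : IdeleClassGroup E →ₜ* Circle}
    {hμ : letI : IsCMField E := isCMField F E; IdeleClassGroup.IsConjugateSymplectic E μ} (t : RestTail C μ hμ)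
    (G' : Type) [Group G'] [TopologicalSpace G'] [IsTopologicalGroup G'] (φ : G' ≃ₜ* C.G)
    (Eps' : Type) (epsOf' : E → Eps') (Chi' : Type) (omega' : Eps' → Chi' → Type)
    [∀ ε χ, AddCommGroup (omega' ε χ)] [∀ ε χ, Module ℂ (omega' ε χ)]
    (rho' : ∀ ε χ, Representation ℂ G' (omega' ε χ)) :
    Thm418AsPrinted ((toThm418Data C (U.rest t)).transport G' φ Eps' epsOf' Chi' omega' rho') ↔
      Thm418AsPrinted ((toThm418Data C (U'.rest t)).transport G' φ Eps' epsOf' Chi' omega' rho') := Iff.rfl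

end Literature.NumberTheory.Automorphic.Liu2021.AppendixC

end
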